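import Summits.CriticalPhenomena.PercolationContinuityZ3.Theorems.FK.ConcaveLimitSlopes
import HarnessLib

/-!
# DERIVATIVES OF POINTWISE LIMITS OF CONVEX FUNCTIONS (the convex twins of `ConcaveLimitSlopes`)

Claimed R42 (8)(c) in the cell INBOX at 2026-08-28T22:45:16Z by fkp-10a gen 356 (NEW CLAIM #2 of the gen), addressed to coordinator fk-4 gen 283 (seated 21:31Z 2026-08-28 by l.8554; R157 in force); lineage row FO-10a-g356p (self-suggested), package g356-pressure, label PD-A.
Helper file of the `fk-continuity` build cell (bschramm lane; `--supports stmt-CriticalPhenomena-4575`); builds on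
p205010 (kernel theorem, internal audit signed; external expert review pending). No definitions, no named facts, no
sorries; standard axioms. Pure real analysis (Mathlib only).

The mirror images (`f ↦ −f`) of the concave statements of `ConcaveLimitSlopes` (Ellis 2006, Lemma IV.6.3: convergence of
derivatives of convex functions `c_Λ → c`), for the convex thermodynamic potentials (pressure, free energy): if
`f_n → g` pointwise on a convex `S`, every `f_n` convex with `f_n'(x) → ℓ`, then `g` is convex, `ℓ ≤ slope g x y` for
`y > x` and `slope g y x ≤ ℓ` for `y < x` (`convexOn_of_tendsto`, `le_slope_of_tendsto_deriv_convex`,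
`slope_le_of_tendsto_deriv_convex`); and the squeeze lemmas with the inequalities oriented for convex functions
(`hasDerivWithinAt_Ioi_of_slope_squeeze_convex`, `hasDerivWithinAt_Iio_of_slope_squeeze_convex`,
`hasDerivAt_of_slope_squeeze_convex`).

## References

* R. S. Ellis, *Entropy, Large Deviations, and Statistical Mechanics*, Springer (1985/2006), Lemma IV.6.3. [Ellis2006]
* R. T. Rockafellar, *Convex Analysis*, Princeton (1970), Thm. 24.1, Thm. 25.7. [Rockafellar1970]
-/

noncomputable section

namespace Summit.CriticalPhenomena.PercolationContinuityZ3.Theorems.FK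

namespace ConcaveLimit

open Filter Topology Set

/-- **A pointwise limit of convex functions is convex.** [cite: Rockafellar1970, Thm. 10.8; Ellis2006, Lemma IV.6.3] -/
theorem convexOn_of_tendsto {S : Set ℝ} (hS : Convex ℝ S) {f : ℕ → ℝ → ℝ} {g : ℝ → ℝ}
    (hf : ∀ n, ConvexOn ℝ S (f n)) (hlim : ∀ x ∈ S, Tendsto (fun n => f n x) atTop (𝓝 (g x))) :
    ConvexOn ℝ S g := by
  refine ⟨hS, fun x hx y hy a b ha hb hab => ?_⟩
  exact le_of_tendsto_of_tendsto' (hlim _ (hS hx hy ha hb hab))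
    (((hlim x hx).const_smul a).add ((hlim y hy).const_smul b)) fun n => (hf n).2 hx hy ha hb hab

/-- **The slope sandwich for convex functions, right side**: `f_n → g` pointwise on the convex `S`, every `f_n`
convex on `S` with derivative `f_n'(x)` at `x ∈ S`, `f_n'(x) → ℓ` ⇒ `ℓ ≤ slope g x y` for `y ∈ S`, `y > x`.
[cite: Ellis2006, Lemma IV.6.3; Rockafellar1970, Thm. 24.1] -/
theorem le_slope_of_tendsto_deriv_convex {S : Set ℝ} {f : ℕ → ℝ → ℝ} {g : ℝ → ℝ} (hf : ∀ n, ConvexOn ℝ S (f n))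
    (hlim : ∀ x ∈ S, Tendsto (fun n => f n x) atTop (𝓝 (g x))) {x : ℝ} (hx : x ∈ S) {f' : ℕ → ℝ} {ℓ : ℝ}
    (hder : ∀ n, HasDerivAt (f n) (f' n) x) (hf' : Tendsto f' atTop (𝓝 ℓ)) {y : ℝ} (hy : y ∈ S) (hxy : x < y) :
    ℓ ≤ slope g x y :=
  le_of_tendsto_of_tendsto' hf' (tendsto_slope_of_tendsto hlim hx hy) fun n =>
    (hf n).le_slope_of_hasDerivAt hx hy hxy (hder n)

/-- **The slope sandwich for convex functions, left side**: under the same hypotheses, `slope g y x ≤ ℓ` for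
`y ∈ S`, `y < x`. [cite: Ellis2006, Lemma IV.6.3; Rockafellar1970, Thm. 24.1] -/
theorem slope_le_of_tendsto_deriv_convex {S : Set ℝ} {f : ℕ → ℝ → ℝ} {g : ℝ → ℝ} (hf : ∀ n, ConvexOn ℝ S (f n))
    (hlim : ∀ x ∈ S, Tendsto (fun n => f n x) atTop (𝓝 (g x))) {x : ℝ} (hx : x ∈ S) {f' : ℕ → ℝ} {ℓ : ℝ}
    (hder : ∀ n, HasDerivAt (f n) (f' n) x) (hf' : Tendsto f' atTop (𝓝 ℓ)) {y : ℝ} (hy : y ∈ S) (hyx : y < x) :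
    slope g y x ≤ ℓ :=
  le_of_tendsto_of_tendsto' (tendsto_slope_of_tendsto hlim hy hx) hf' fun n =>
    (hf n).slope_le_of_hasDerivAt hy hx hyx (hder n)

/-- **Squeeze to a right derivative, convex orientation**: `ℓ ≤ slope g x y ≤ u y` for `y ↓ x` with `u y → ℓ` gives
the right derivative `ℓ`. [folklore] -/
theorem hasDerivWithinAt_Ioi_of_slope_squeeze_convex {g u : ℝ → ℝ} {x ℓ : ℝ}
    (hlo : ∀ᶠ y in 𝓝[>] x, ℓ ≤ slope g x y) (hup : ∀ᶠ y in 𝓝[>] x, slope g x y ≤ u y)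
    (hu : Tendsto u (𝓝[>] x) (𝓝 ℓ)) : HasDerivWithinAt g ℓ (Ioi x) x := by
  rw [hasDerivWithinAt_iff_tendsto_slope, sdiff_singleton_eq_self fun h : x ∈ Ioi x => lt_irrefl x h]
  exact tendsto_of_tendsto_of_tendsto_of_le_of_le' tendsto_const_nhds hu hlo hup

/-- **Squeeze to a left derivative, convex orientation**: `u y ≤ slope g y x ≤ ℓ` for `y ↑ x` with `u y → ℓ` gives
the left derivative `ℓ`. [folklore] -/
theorem hasDerivWithinAt_Iio_of_slope_squeeze_convex {g u : ℝ → ℝ} {x ℓ : ℝ}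
    (hlo : ∀ᶠ y in 𝓝[<] x, u y ≤ slope g y x) (hup : ∀ᶠ y in 𝓝[<] x, slope g y x ≤ ℓ)
    (hu : Tendsto u (𝓝[<] x) (𝓝 ℓ)) : HasDerivWithinAt g ℓ (Iio x) x := by
  rw [hasDerivWithinAt_iff_tendsto_slope, sdiff_singleton_eq_self fun h : x ∈ Iio x => lt_irrefl x h]
  refine tendsto_of_tendsto_of_tendsto_of_le_of_le' hu tendsto_const_nhds ?_ ?_
  · filter_upwards [hlo] with y hy; rwa [slope_comm]
  · filter_upwards [hup] with y hy; rwa [slope_comm]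

/-- **Squeeze to a derivative, convex orientation.** [folklore] -/
theorem hasDerivAt_of_slope_squeeze_convex {g u v : ℝ → ℝ} {x ℓ : ℝ}
    (hlo : ∀ᶠ y in 𝓝[>] x, ℓ ≤ slope g x y) (hup : ∀ᶠ y in 𝓝[>] x, slope g x y ≤ u y)
    (hu : Tendsto u (𝓝[>] x) (𝓝 ℓ)) (hlo' : ∀ᶠ y in 𝓝[<] x, v y ≤ slope g y x)
    (hup' : ∀ᶠ y in 𝓝[<] x, slope g y x ≤ ℓ) (hv : Tendsto v (𝓝[<] x) (𝓝 ℓ)) : HasDerivAt g ℓ x := by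
  have hr := hasDerivWithinAt_Ioi_of_slope_squeeze_convex hlo hup hu
  have hl := hasDerivWithinAt_Iio_of_slope_squeeze_convex hlo' hup' hv
  rw [hasDerivWithinAt_iff_tendsto_slope, sdiff_singleton_eq_self fun h : x ∈ Ioi x => lt_irrefl x h] at hr
  rw [hasDerivWithinAt_iff_tendsto_slope, sdiff_singleton_eq_self fun h : x ∈ Iio x => lt_irrefl x h] at hl
  rw [hasDerivAt_iff_tendsto_slope, ← nhdsLT_sup_nhdsGT]
  exact hl.sup hr

end ConcaveLimit

end Summit.CriticalPhenomena.PercolationContinuityZ3.Theorems.FK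

end
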